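import Mathlib
import HarnessLib
import Literature.Combinatorics.Additive.StepBeyondKempermanStanding
import Literature.Combinatorics.Additive.StepBeyondKempermanUniqueSums
import Literature.Combinatorics.Additive.StepBeyondKempermanDualThree

/-!
# Grynkiewicz 2009, Theorem 4.1 for finite `G`: reduction to Claim 5 and the deep core (§6 up to Claim 8)

[cite: Grynkiewicz2009, §6 (proof of Thm 4.1, pp. 23–28)] [tag: critical-pair] [tag: inverse-theorem]

Topic `Literature/Combinatorics/Additive`.  Cell `mm-stpp` (D-0046), seat `mm-stpp-lit` (gen 23); the
port of D. J. Grynkiewicz, *A step beyond Kemperman's structure theorem*, Mathematika **55** (2009)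
67–114 continued.  This file ASSEMBLES the kernel-checked opening of the proof of Theorem 4.1 (§6,
print pp. 23–28: «w.l.o.g. `0 ∈ A ∩ B`», extendible ⟹ (17), Claims 1–4, Claim 6, CASE I's standing
assumptions (47)–(51), Claim 8, and the paragraph «`|A| = |\overline{A + B}| = 3` ⟹ type (VII)») into
one checkpoint: for a FINITE abelian group `G`, Theorem 4.1 (first part) follows from two remaining
printed blocks, taken here as hypotheses about pairs inside subgroups `G′ ≤ G` —
* **Claim 5** («`d⊆(A + B, 𝒫) ≥ 3`», print pp. 24–26: under the core-case assumptions, a periodic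
  superset of `A + B` with at most two new elements forces (17) or a type (VIII) decomposition), and
* the **deep core** (print pp. 28–34: Claims 9–10 and Subcases 1–4 of CASE I): the conclusion for
  pairs satisfying the core-case assumptions together with `d⊆(A + B, 𝒫) ≥ 3`, `|B| ≥ 4`, (47), (48),
  (49), (50), (51), the Claim-8 bounds `|N₁ᵇ(A, B)|, |N₁ᵃ(B, A)| ≤ 1`, and «not both `|A|` and
  `|\overline{A + B}|` equal `3`».
Every other step is a tree theorem: `conclusion_of_core` (Claims 1–4), `conclusion_of_card_eq_three`
(Claim 6), `two_le_subsetDist_isQuasiPeriodic_or_seventeen` (47), `three_le_card_sdiff_compl_or_seventeen`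
(48), `two_le_subsetDist_compl_isQuasiPeriodic` (49), `seventeen_of_subsetDist_quasiProgression_le_one`
(+`_right`) (50), `two_le_subsetDist_compl_quasiProgression` (51), `card_layerWith_le_one_and_or_seventeen`
(Claim 8), `conclusion_of_card_eq_three_of_card_compl_eq_three` (type (VII) paragraph).

MAIN RESULT (0 definitions, 0 named facts; everything PROVED).
* `Grynkiewicz2009.conclusion_of_claim5_of_deepCore` — **THEOREM 4.1 (FIRST PART) FOR FINITE `G`,
  MODULO CLAIM 5 AND THE DEEP CORE.**

## References
* D. J. Grynkiewicz, *A step beyond Kemperman's structure theorem*, Mathematika 55 (2009) 67–114,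
  doi:10.1112/S0025579300000966, §6 (proof of Thm 4.1, pp. 23–28) [cite: Grynkiewicz2009, Thm 4.1
  (proof)] — held `paper:doi-10-1112-s0025579300000966`, `paper:arxiv-0710.1041`, read 2026-08-29.
-/

namespace Literature.Combinatorics.Additive

open Finset
open scoped Pointwise

universe u

variable {G : Type u} [AddCommGroup G] [DecidableEq G]

namespace Grynkiewicz2009

/-- In `ℕ∞`: not `≥ 2` means `≤ 1`. [folklore] -/
private theorem le_one_of_not_two_le' {x : ℕ∞} (h : ¬ 2 ≤ x) : x ≤ 1 := by
  by_contra h1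
  exact h (by
    have := Order.add_one_le_of_lt (not_le.1 h1)
    rwa [one_add_one_eq_two] at this)

/-- `d⊆(A + B, 𝒫) ≥ 3` gives `|\overline{A + B}| ≥ 3` (take `P = G`), for `|A| ≥ 2`.
[cite: Grynkiewicz2009, §6 (CASE I: «note Claim 5 implies |\overline{A+B}| ≥ 3»)] -/
theorem three_le_card_compl_of_forall {K : Type u} [AddCommGroup K] [DecidableEq K] [Fintype K]
    {A B : Finset K} (hA2 : 2 ≤ #A)
    (hP3 : ∀ P : Finset K, A + B ⊆ P → P.addStab ≠ {0} → 3 ≤ #(P \ (A + B))) :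
    3 ≤ #(A + B)ᶜ := by
  have huniv : (univ : Finset K).addStab ≠ {0} := by
    intro h
    obtain ⟨x, hx, y, hy, hxy⟩ := one_lt_card.1 (by omega : 1 < #A)
    have hmem : x - y ∈ (univ : Finset K).addStab := by
      rw [mem_addStab univ_nonempty]; exact vadd_finset_univ
    rw [h, mem_singleton, sub_eq_zero] at hmem
    exact hxy hmem
  have := hP3 univ (subset_univ _) huniv
  rwa [← compl_eq_univ_sdiff] at this

/-- **Theorem 4.1 (first part) for finite `G`, modulo Claim 5 and the deep core.**  Let `G` be a finite
abelian group.  Suppose that for every subgroup `G′ ≤ G` and all finsets `A, B` of `↥G′` satisfying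
the CORE-CASE ASSUMPTIONS (`0 ∈ A ∩ B`, `|A|, |B| ≥ 3`, `|A + B| = |A| + |B|`, `A + B` aperiodic,
`d⊆(A + B, 𝒫) ≥ 2`, `(A, B)` non-extendible, `A`, `B` not quasi-periodic, `⟨A⟩ = ⟨B⟩ = G′`):
(Claim 5) if some periodic `P ⊇ A + B` has `|P ∖ (A + B)| ≤ 2` then the conclusion of Theorem 4.1 holds;
(deep core) if moreover `d⊆(A + B, 𝒫) ≥ 3`, `|B| ≥ 4`, (47) `d⊆(A, 𝒬𝒫), d⊆(B, 𝒬𝒫) ≥ 2`, (48)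
`d⊆(Ā, 𝒫), d⊆(B̄, 𝒫) ≥ 3`, (49) `d⊆(\overline{A + B}, 𝒬𝒫) ≥ 2`, (50) `d⊆(A, 𝒬𝒜𝒫_d), d⊆(B, 𝒬𝒜𝒫_d) ≥ 2`
and (51) `d⊆(\overline{A + B}, 𝒬𝒜𝒫_d) ≥ 2` for all nonzero `d`, `|N₁ᵇ(A, B)| ≤ 1` for all `b ∈ B`,
`|N₁ᵃ(B, A)| ≤ 1` for all `a ∈ A`, and not both `|A| = 3` and `|\overline{A + B}| = 3`, then the
conclusion holds.  Then the conclusion of Theorem 4.1 — (17), or a decomposition (i)–(iii) — holds for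
every pair of nonempty `A, B ⊆ G` with `|A + B| = |A| + |B|` and `A + B` aperiodic.
[cite: Grynkiewicz2009, §6 (proof of Thm 4.1, pp. 23–28)] -/
theorem conclusion_of_claim5_of_deepCore [Fintype G]
    (claim5 : ∀ (G' : AddSubgroup G) [Fintype ↥G'] (A B : Finset ↥G'),
      (0 : ↥G') ∈ A → (0 : ↥G') ∈ B → 3 ≤ #A → 3 ≤ #B → #(A + B) = #A + #B →
      (A + B).addStab = {0} →
      (∀ P : Finset ↥G', A + B ⊆ P → P.addStab ≠ {0} → 2 ≤ #(P \ (A + B))) →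
      IsNonExtendible A B → IsNonExtendible B A → ¬ IsQuasiPeriodic A → ¬ IsQuasiPeriodic B →
      AddSubgroup.closure (A : Set ↥G') = ⊤ → AddSubgroup.closure (B : Set ↥G') = ⊤ →
      (∃ P : Finset ↥G', A + B ⊆ P ∧ P.addStab ≠ {0} ∧ #(P \ (A + B)) ≤ 2) →
      ((∃ α β : ↥G', #(insert α A + insert β B) + 1 = #(insert α A) + #(insert β B)) ∨
        ∃ (K : AddSubgroup ↥G') (A₁ A₀ B₁ B₀ : Finset ↥G'), IsGrynkiewiczDecomp K A B A₁ A₀ B₁ B₀))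
    (deep : ∀ (G' : AddSubgroup G) [Fintype ↥G'] (A B : Finset ↥G'),
      (0 : ↥G') ∈ A → (0 : ↥G') ∈ B → 3 ≤ #A → 4 ≤ #B → #(A + B) = #A + #B →
      (A + B).addStab = {0} →
      (∀ P : Finset ↥G', A + B ⊆ P → P.addStab ≠ {0} → 3 ≤ #(P \ (A + B))) →
      IsNonExtendible A B → IsNonExtendible B A → ¬ IsQuasiPeriodic A → ¬ IsQuasiPeriodic B →
      AddSubgroup.closure (A : Set ↥G') = ⊤ → AddSubgroup.closure (B : Set ↥G') = ⊤ →
      2 ≤ subsetDist A {P | IsQuasiPeriodic P} → 2 ≤ subsetDist B {P | IsQuasiPeriodic P} →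
      (∀ P : Finset ↥G', Aᶜ ⊆ P → P.addStab ≠ {0} → 3 ≤ #(P \ Aᶜ)) →
      (∀ P : Finset ↥G', Bᶜ ⊆ P → P.addStab ≠ {0} → 3 ≤ #(P \ Bᶜ)) →
      2 ≤ subsetDist (A + B)ᶜ {P | IsQuasiPeriodic P} →
      (∀ d : ↥G', d ≠ 0 → 2 ≤ subsetDist A {P | IsQuasiProgression d P}) →
      (∀ d : ↥G', d ≠ 0 → 2 ≤ subsetDist B {P | IsQuasiProgression d P}) →
      (∀ d : ↥G', d ≠ 0 → 2 ≤ subsetDist (A + B)ᶜ {P | IsQuasiProgression d P}) →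
      (∀ b ∈ B, #(layerWith A B 1 {b}) ≤ 1) → (∀ a ∈ A, #(layerWith B A 1 {a}) ≤ 1) →
      ¬ (#A = 3 ∧ #(A + B)ᶜ = 3) →
      ((∃ α β : ↥G', #(insert α A + insert β B) + 1 = #(insert α A) + #(insert β B)) ∨
        ∃ (K : AddSubgroup ↥G') (A₁ A₀ B₁ B₀ : Finset ↥G'), IsGrynkiewiczDecomp K A B A₁ A₀ B₁ B₀))
    {A B : Finset G} (hA : A.Nonempty) (hB : B.Nonempty) (hAB : #(A + B) = #A + #B)
    (haper : (A + B).addStab = {0}) :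
    (∃ α β : G, #(insert α A + insert β B) + 1 = #(insert α A) + #(insert β B)) ∨
      ∃ (K : AddSubgroup G) (A₁ A₀ B₁ B₀ : Finset G), IsGrynkiewiczDecomp K A B A₁ A₀ B₁ B₀ := by
  classical
  refine conclusion_of_core ?_ hA hB hAB haper
  intro G' A B h0A h0B hA3 hB3 hAB haper hP2 hneA hneB hAqp hBqp hgenA hgenB
  haveI : Fintype ↥G' := Fintype.ofFinite _
  -- Claim 5
  by_cases hP3 : ∀ P : Finset ↥G', A + B ⊆ P → P.addStab ≠ {0} → 3 ≤ #(P \ (A + B))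
  swap
  · push Not at hP3
    obtain ⟨P, h1, h2, h3⟩ := hP3
    exact claim5 G' A B h0A h0B hA3 hB3 hAB haper hP2 hneA hneB hAqp hBqp hgenA hgenB
      ⟨P, h1, h2, by omega⟩
  -- Claim 6 and «say |B| ≥ 4»
  suffices main : ∀ A B : Finset ↥G', (0 : ↥G') ∈ A → (0 : ↥G') ∈ B → 3 ≤ #A → 4 ≤ #B →
      #(A + B) = #A + #B → (A + B).addStab = {0} →
      (∀ P : Finset ↥G', A + B ⊆ P → P.addStab ≠ {0} → 3 ≤ #(P \ (A + B))) →
      IsNonExtendible A B → IsNonExtendible B A → ¬ IsQuasiPeriodic A → ¬ IsQuasiPeriodic B →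
      AddSubgroup.closure (A : Set ↥G') = ⊤ → AddSubgroup.closure (B : Set ↥G') = ⊤ →
      ((∃ α β : ↥G', #(insert α A + insert β B) + 1 = #(insert α A) + #(insert β B)) ∨
        ∃ (K : AddSubgroup ↥G') (A₁ A₀ B₁ B₀ : Finset ↥G'), IsGrynkiewiczDecomp K A B A₁ A₀ B₁ B₀) by
    by_cases hB4 : 4 ≤ #B
    · exact main A B h0A h0B hA3 hB4 hAB haper hP3 hneA hneB hAqp hBqp hgenA hgenB
    by_cases hA4 : 4 ≤ #A
    · have hBA : #(B + A) = #B + #A := by rw [add_comm, hAB, add_comm]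
      have haper' : (B + A).addStab = {0} := by rwa [add_comm]
      have hP3' : ∀ P : Finset ↥G', B + A ⊆ P → P.addStab ≠ {0} → 3 ≤ #(P \ (B + A)) := by
        rw [add_comm]; exact hP3
      exact conclusion_symm (main B A h0B h0A hB3 hA4 hBA haper' hP3' hneB hneA hBqp hAqp hgenB hgenA)
    · exact conclusion_of_card_eq_three (by omega) (by omega) hAB haper hAqp hBqp
  intro A B h0A h0B hA3 hB4 hAB haper hP3 hneA hneB hAqp hBqp hgenA hgenB
  have hB3 : 3 ≤ #B := by omega
  have hC3 : 3 ≤ #(A + B)ᶜ := three_le_card_compl_of_forall (by omega) hP3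
  -- (47)
  rcases two_le_subsetDist_isQuasiPeriodic_or_seventeen hA3 hB3 (Or.inr hB4) h0A h0B hAB hP3 hneA hneB
    hgenA hgenB hAqp hBqp with ⟨h47A, h47B⟩ | h17
  swap
  · exact Or.inl h17
  -- (48)
  rcases three_le_card_sdiff_compl_or_seventeen hA3 hB3 h0A h0B hAB hP3 hneA hneB hgenA hAqp with
    h48A | h17
  swap
  · exact Or.inl h17
  rcases three_le_card_sdiff_compl_or_seventeen_right hA3 hB3 h0A h0B hAB hP3 hneA hneB hgenB hBqp
    with h48B | h17
  swap
  · exact Or.inl h17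
  -- (49)
  have h49 := two_le_subsetDist_compl_isQuasiPeriodic h0A h0B hA3 hB4 hC3 hAB haper h48A hneA hneB
    hgenA hAqp h47B
  -- «|A| = |(A + B)ᶜ| = 3 ⟹ type (VII)»
  by_cases h33 : #A = 3 ∧ #(A + B)ᶜ = 3
  · exact conclusion_of_card_eq_three_of_card_compl_eq_three h0A h0B h33.1 hB3 h33.2 hAB haper hneA
      hneB hgenA hAqp hBqp
  -- (50)
  by_cases h50A : ∀ d : ↥G', d ≠ 0 → 2 ≤ subsetDist A {P | IsQuasiProgression d P}
  swap
  · push Not at h50A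
    obtain ⟨d, hd, hlt⟩ := h50A
    exact Or.inl (seventeen_of_subsetDist_quasiProgression_le_one hA3 hB3 h0A h0B hAB hP3 hneA hneB
      hgenA h47A hd (le_one_of_not_two_le' (not_le.2 hlt)) fun h3 hC => h33 ⟨h3, hC⟩)
  by_cases h50B : ∀ d : ↥G', d ≠ 0 → 2 ≤ subsetDist B {P | IsQuasiProgression d P}
  swap
  · push Not at h50B
    obtain ⟨d, hd, hlt⟩ := h50B
    exact Or.inl (seventeen_of_subsetDist_quasiProgression_le_one_right hA3 hB3 h0A h0B hAB hP3 hneA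
      hneB hgenB h47B hd (le_one_of_not_two_le' (not_le.2 hlt)) fun h3 => absurd h3 (by omega))
  -- (51)
  have h51 : ∀ d : ↥G', d ≠ 0 → 2 ≤ subsetDist (A + B)ᶜ {P | IsQuasiProgression d P} :=
    fun d hd => two_le_subsetDist_compl_quasiProgression h0A h0B hA3 hB3 hC3 hAB haper h48A hneA hneB
      hgenA hAqp h47B h50B h49 (fun hC h3 => h33 ⟨h3, hC⟩) hd
  -- Claim 8
  rcases card_layerWith_le_one_and_or_seventeen h0A h0B hA3 hB3 hAB haper hneA hneB hgenA hgenB hAqp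
    hBqp with ⟨hN1B, hN1A⟩ | h17
  swap
  · exact Or.inl h17
  exact deep G' A B h0A h0B hA3 hB4 hAB haper hP3 hneA hneB hAqp hBqp hgenA hgenB h47A h47B h48A h48B
    h49 h50A h50B h51 hN1B hN1A h33

end Grynkiewicz2009

end Literature.Combinatorics.Additive
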